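import Summits.KontsevichZagierPeriods.Zeta5Search.Barrier.ConeGammaWallOrientation
import Summits.KontsevichZagierPeriods.Zeta5Search.Barrier.ConeGammaCuspSymmetricTwoWallValue

/-!
# ζ(5) search — BARRIER: the reflection defects are BOUNDED — `|D_b(x)| ≤ min(#neg, #pos)`; `D_b ∈ {−1,0,+1}` at every two-wall junction

HONEST FRAMING (cell `pub-zeta5`): systematic search; no irrationality claim unless kernel-certified. MODEL objects
under Brown–Zudilin's (28)+(30) accounting ([BZ22] = arXiv:2210.03391; (28) observed, not proved); nothing here is a
statement about `ζ(5)`, any `γ` of record, the cone's supremum (C2 OPEN) or the SIGN of any reflection defect at a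
named direction (DATA of the cell); S-E stays CONJECTURED; records in print UNMOVED. Prover P2 g26, companion of
`ConeGammaWallOrientation` (item «wall orientation» = P2 g25's successor menu (d); lead's ruling lit g37, INBOX
2026-08-27).

`ConeGammaCuspSymmetricWalls` / `…Patterns` / `…TwoWallValue` (P2 g25) reduce the symmetric part `σ(δ) + σ(−δ)` of the
cusp slope to REFLECTION DEFECTS `𝒩(θ_b+Δ) + 𝒩(θ_b−Δ) − 𝒩(θ_b+t·s) − 𝒩(θ_b−t·s)` of small displacements `Δ` at the
breakpoints `b` (one integer per member-sign pattern; `D_b` at a two-wall junction), whose VALUES were DATA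
(`D_b ∈ {−1,0,+1}` observed along the ridge). With the oriented Lipschitz bound of `ConeGammaWallOrientation`:
* **`abs_reflDefect_le_card`** — at `b ∈ bkpts a T` (all 28 forms positive), for a displacement `Δ` below the wall
  distance with non-zero member forms and a line step `t` below the walls: `|defect(Δ)| ≤ #S` for ANY finset `S`
  containing the members `k` with `φ_k(Δ) < 0`; **`abs_reflDefect_le_card_pos`** — likewise with the members
  `φ_k(Δ) > 0`. (Write `defect = [𝒩(θ_b+Δ) − 𝒩(θ_b+t·s)] + [𝒩(θ_b−Δ) − 𝒩(θ_b−t·s)]`: the floors move by `−1` resp.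
  `+1` exactly on the negative members, and the FAVOURABLE counts of the two brackets add up to their number.) So a
  pattern's defect is at most `min(#members flipped, #members kept)`.
* **`reflDefect_two_wall_mem`** — at a junction whose members are among `k₁ ≠ k₂`, the two-wall vote satisfies
  `D_b = −1 ∨ D_b = 0 ∨ D_b = +1` (P2 g25's menu (d): a THEOREM, not data); **`abs_reflDefect_three_wall_le_one`** —
  with members among three forms, every pattern defect has `|·| ≤ 1` (`±2` needs `≥ 4` walls; desk: first seen at 5).
* **`abs_germ_symm_le_splitting_of_two_wall`** — with `germ_symm_eq_two_wall`: the four-germ sum at a two-wall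
  junction obeys `|R_b(δ)| ≤ |φ_{k₁}(δ)/h_{k₁}(a) − φ_{k₂}(δ)/h_{k₂}(a)|` for EVERY displacement `δ` — a two-wall
  junction's vote is bounded by how far `δ` splits its two walls.
DESK (DATA, `HOME/pub-zeta5-p2/g26/alg/orient.py`): `|D_b(x)| ≤ min(#neg, #pos)` holds with 0 violations on 20,888
patterns at record/41, flag/60, argmax-120, t*/480; four-wall junctions never attain `±2` there. NOT here (honest):
the sign of any `D_b` (DATA), `≥ 4`-wall values, anything about `γ`, C2, S-E, `ζ(5)`.
-/

noncomputable section

open Set MeasureTheory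
open scoped Topology

namespace Summit.KontsevichZagierPeriods.Zeta5Search.Barrier.ConeGamma

/-- `Σ_{k∈F} [k ∈ S] + Σ_{k∉F} [k ∈ S] = #S`. -/
theorem sum_indicator_FIdx_add_compl (S : Finset (Fin 28)) :
    ∑ k ∈ FIdx, (if k ∈ S then (1 : ℤ) else 0) + ∑ k ∈ FIdxᶜ, (if k ∈ S then (1 : ℤ) else 0) = S.card := by
  rw [Finset.sum_add_sum_compl FIdx (fun k => if k ∈ S then (1 : ℤ) else 0), Finset.sum_boole,
    Finset.filter_mem_eq_inter, Finset.univ_inter]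

/-- **THE REFLECTION DEFECT IS BOUNDED BY THE NUMBER OF NEGATIVE MEMBERS.** Let all 28 forms of `a` be positive,
`b ∈ bkpts a T`, `Δ` a displacement with forms `< 1` and `< wallDist a T` whose MEMBER forms (`b·h_k(a) ∈ ℤ`) are
non-zero, `t > 0` a line step with `t·x_max < 1`, `t·x_max < wallDist a T`, and `S` any finset containing every member
`k` with `φ_k(Δ) < 0`. Then `|𝒩(θ_b+Δ) + 𝒩(θ_b−Δ) − 𝒩(θ_b+t·s) − 𝒩(θ_b−t·s)| ≤ #S` (`θ_b = b·s(a)`). Proof: against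
`θ_b + t·s` the floors of `θ_b + Δ` are down by one exactly on the negative members, against `θ_b − t·s` those of
`θ_b − Δ` are up by one exactly there; by the oriented Lipschitz bound the first bracket is at most the number of
those outside `F` and the second at most the number inside `F` (and symmetrically from below). -/
theorem abs_reflDefect_le_card {a : Dir} (hpos : ∀ k, 0 < h28 a k) {T b : ℝ} (hb : b ∈ bkpts a T)
    {Δ : Fin 8 → ℝ} (hΔ1 : ∀ k, |phiForm Δ k| < 1) (hΔ2 : ∀ k, |phiForm Δ k| < wallDist a T)
    (hnz : ∀ k, (∃ z : ℤ, b * h28 a k = z) → phiForm Δ k ≠ 0)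
    {t : ℝ} (ht : 0 < t) (ht1 : t * xMax a < 1) (ht2 : t * xMax a < wallDist a T)
    {S : Finset (Fin 28)} (hS : ∀ k, (∃ z : ℤ, b * h28 a k = z) → phiForm Δ k < 0 → k ∈ S) :
    |(torusN (b • sParam a + Δ) : ℝ) + torusN (b • sParam a - Δ) -
        (torusN (b • sParam a + t • sParam a) + torusN (b • sParam a - t • sParam a))| ≤ S.card := by
  -- the four points as `θ_b + displacement`
  have eM : b • sParam a - Δ = b • sParam a + -Δ := sub_eq_add_neg _ _
  have eL : b • sParam a - t • sParam a = b • sParam a + (-t) • sParam a := by rw [neg_smul, sub_eq_add_neg]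
  have hs1 := fun k => phiForm_line_step_small hpos ht ht1 k
  have hs2 := fun k => phiForm_line_step_small hpos ht ht2 k
  have hnΔ1 : ∀ k, |phiForm (-Δ) k| < 1 := fun k => by rw [phiForm_neg, abs_neg]; exact hΔ1 k
  have hnΔ2 : ∀ k, |phiForm (-Δ) k| < wallDist a T := fun k => by rw [phiForm_neg, abs_neg]; exact hΔ2 k
  -- floors at the four points
  have fP := fun k => floor_phiForm_bkpt_add hb hΔ1 hΔ2 k
  have fM := fun k => floor_phiForm_bkpt_add hb hnΔ1 hnΔ2 k
  have fR := fun k => floor_phiForm_bkpt_add hb (Δ := t • sParam a) (fun k => (hs1 k).2.2.2.1)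
    (fun k => (hs2 k).2.2.2.1) k
  have fL := fun k => floor_phiForm_bkpt_add hb (Δ := (-t) • sParam a) (fun k => (hs1 k).2.2.2.2)
    (fun k => (hs2 k).2.2.2.2) k
  -- pointwise: the four increments that enter the oriented bounds
  have hpt : ∀ k,
      max (⌊phiForm (b • sParam a + Δ) k⌋ - ⌊phiForm (b • sParam a + t • sParam a) k⌋) 0 = 0 ∧
      max (⌊phiForm (b • sParam a + t • sParam a) k⌋ - ⌊phiForm (b • sParam a + Δ) k⌋) 0 ≤
        (if k ∈ S then (1 : ℤ) else 0) ∧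
      max (⌊phiForm (b • sParam a + -Δ) k⌋ - ⌊phiForm (b • sParam a + (-t) • sParam a) k⌋) 0 ≤
        (if k ∈ S then (1 : ℤ) else 0) ∧
      max (⌊phiForm (b • sParam a + (-t) • sParam a) k⌋ - ⌊phiForm (b • sParam a + -Δ) k⌋) 0 = 0 := by
    intro k
    obtain ⟨e1, e2, hp, -, -⟩ := hs1 k
    have hind : (0 : ℤ) ≤ if k ∈ S then (1 : ℤ) else 0 := by split_ifs <;> norm_num
    by_cases hm : ∃ z : ℤ, b * h28 a k = z
    · obtain ⟨z, hz⟩ := hm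
      have rR : ⌊phiForm (b • sParam a + t • sParam a) k⌋ = z := (fR k).1 z hz (by rw [e1]; exact hp)
      have rL : ⌊phiForm (b • sParam a + (-t) • sParam a) k⌋ = z - 1 := (fL k).2.1 z hz (by rw [e2]; linarith)
      rcases lt_or_gt_of_ne (hnz k ⟨z, hz⟩) with hn | hpk
      · -- negative member: floors `z − 1` at `θ_b + Δ`, `z` at `θ_b − Δ`; `k ∈ S`
        have hkS : k ∈ S := hS k ⟨z, hz⟩ hn
        have rP : ⌊phiForm (b • sParam a + Δ) k⌋ = z - 1 := (fP k).2.1 z hz hn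
        have rM : ⌊phiForm (b • sParam a + -Δ) k⌋ = z := (fM k).1 z hz (by rw [phiForm_neg]; linarith)
        rw [rP, rM, rR, rL, if_pos hkS]
        refine ⟨by simp, by simp, by simp, by simp⟩
      · -- positive member: floors `z` at `θ_b + Δ`, `z − 1` at `θ_b − Δ`
        have rP : ⌊phiForm (b • sParam a + Δ) k⌋ = z := (fP k).1 z hz hpk
        have rM : ⌊phiForm (b • sParam a + -Δ) k⌋ = z - 1 :=
          (fM k).2.1 z hz (by rw [phiForm_neg]; linarith)
        rw [rP, rM, rR, rL]
        refine ⟨by simp, by simp [hind], by simp [hind], by simp⟩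
    · push Not at hm
      rw [(fP k).2.2 hm, (fM k).2.2 hm, (fR k).2.2 hm, (fL k).2.2 hm]
      refine ⟨by simp, by simp [hind], by simp [hind], by simp⟩
  -- the four oriented bounds
  have hU1 := torusN_sub_le_oriented (b • sParam a + t • sParam a) (b • sParam a + Δ)
  have hL1 := oriented_le_torusN_sub (b • sParam a + t • sParam a) (b • sParam a + Δ)
  have hU2 := torusN_sub_le_oriented (b • sParam a + (-t) • sParam a) (b • sParam a + -Δ)
  have hL2 := oriented_le_torusN_sub (b • sParam a + (-t) • sParam a) (b • sParam a + -Δ)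
  have z1 : ∀ s : Finset (Fin 28),
      ∑ k ∈ s, max (⌊phiForm (b • sParam a + Δ) k⌋ - ⌊phiForm (b • sParam a + t • sParam a) k⌋) 0 = 0 :=
    fun s => Finset.sum_eq_zero fun k _ => (hpt k).1
  have z4 : ∀ s : Finset (Fin 28),
      ∑ k ∈ s, max (⌊phiForm (b • sParam a + (-t) • sParam a) k⌋ - ⌊phiForm (b • sParam a + -Δ) k⌋) 0 = 0 :=
    fun s => Finset.sum_eq_zero fun k _ => (hpt k).2.2.2
  have b2 : ∀ s : Finset (Fin 28),
      ∑ k ∈ s, max (⌊phiForm (b • sParam a + t • sParam a) k⌋ - ⌊phiForm (b • sParam a + Δ) k⌋) 0 ≤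
        ∑ k ∈ s, (if k ∈ S then (1 : ℤ) else 0) :=
    fun s => Finset.sum_le_sum fun k _ => (hpt k).2.1
  have b3 : ∀ s : Finset (Fin 28),
      ∑ k ∈ s, max (⌊phiForm (b • sParam a + -Δ) k⌋ - ⌊phiForm (b • sParam a + (-t) • sParam a) k⌋) 0 ≤
        ∑ k ∈ s, (if k ∈ S then (1 : ℤ) else 0) :=
    fun s => Finset.sum_le_sum fun k _ => (hpt k).2.2.1
  have hcard := sum_indicator_FIdx_add_compl S
  have hZ : -(S.card : ℤ) ≤ torusN (b • sParam a + Δ) + torusN (b • sParam a + -Δ) -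
        (torusN (b • sParam a + t • sParam a) + torusN (b • sParam a + (-t) • sParam a)) ∧
      torusN (b • sParam a + Δ) + torusN (b • sParam a + -Δ) -
        (torusN (b • sParam a + t • sParam a) + torusN (b • sParam a + (-t) • sParam a)) ≤ S.card := by
    have := z1 FIdx; have := z1 FIdxᶜ; have := z4 FIdx; have := z4 FIdxᶜ
    have := b2 FIdx; have := b2 FIdxᶜ; have := b3 FIdx; have := b3 FIdxᶜ
    constructor <;> linarith
  rw [eM, eL, abs_le]
  constructor <;> exact_mod_cast (by linarith [hZ.1, hZ.2] : _ )

/-- **The mirrored bound**: `|defect(Δ)| ≤ #S` for any finset `S` containing every member `k` with `φ_k(Δ) > 0`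
(the defect is even in `Δ`; apply `abs_reflDefect_le_card` to `−Δ`). Together: `|defect| ≤ min(#neg, #pos)`. -/
theorem abs_reflDefect_le_card_pos {a : Dir} (hpos : ∀ k, 0 < h28 a k) {T b : ℝ} (hb : b ∈ bkpts a T)
    {Δ : Fin 8 → ℝ} (hΔ1 : ∀ k, |phiForm Δ k| < 1) (hΔ2 : ∀ k, |phiForm Δ k| < wallDist a T)
    (hnz : ∀ k, (∃ z : ℤ, b * h28 a k = z) → phiForm Δ k ≠ 0)
    {t : ℝ} (ht : 0 < t) (ht1 : t * xMax a < 1) (ht2 : t * xMax a < wallDist a T)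
    {S : Finset (Fin 28)} (hS : ∀ k, (∃ z : ℤ, b * h28 a k = z) → 0 < phiForm Δ k → k ∈ S) :
    |(torusN (b • sParam a + Δ) : ℝ) + torusN (b • sParam a - Δ) -
        (torusN (b • sParam a + t • sParam a) + torusN (b • sParam a - t • sParam a))| ≤ S.card := by
  have h := abs_reflDefect_le_card hpos hb (Δ := -Δ) (fun k => by rw [phiForm_neg, abs_neg]; exact hΔ1 k)
    (fun k => by rw [phiForm_neg, abs_neg]; exact hΔ2 k)
    (fun k hk => by rw [phiForm_neg]; exact neg_ne_zero.mpr (hnz k hk)) ht ht1 ht2 (S := S)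
    (fun k hk hn => hS k hk (by rw [phiForm_neg] at hn; linarith))
  rw [sub_neg_eq_add, ← sub_eq_add_neg] at h
  rwa [show (torusN (b • sParam a - Δ) : ℝ) + torusN (b • sParam a + Δ) =
    torusN (b • sParam a + Δ) + torusN (b • sParam a - Δ) from add_comm _ _] at h

/-! ### Two and three walls -/

/-- **`D_b ∈ {−1, 0, +1}` AT EVERY TWO-WALL JUNCTION** (P2 g25's successor menu (d), now a theorem). Let the member
forms at `b ∈ bkpts a T` be among `k₁ ≠ k₂` (`hother`), and let `D_b` be the reflection defect of a small MIXED
displacement `Δ₁` (`φ_{k₁}(Δ₁) > 0 > φ_{k₂}(Δ₁)`, forms `< 1` and `< wallDist`) against a line step `t` below the walls —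
the number that `germ_symm_sign_of_two_wall` / `germ_symm_eq_two_wall` call the junction's vote. Then
`D_b = −1 ∨ D_b = 0 ∨ D_b = +1` (one negative member: `|D_b| ≤ 1`, and `D_b` is an integer). -/
theorem reflDefect_two_wall_mem {a : Dir} (hpos : ∀ k, 0 < h28 a k) {T b : ℝ} (hb : b ∈ bkpts a T)
    {k₁ k₂ : Fin 28} (hother : ∀ k, k ≠ k₁ → k ≠ k₂ → ∀ z : ℤ, b * h28 a k ≠ z) {Δ₁ : Fin 8 → ℝ}
    (hΔ₁1 : ∀ k, |phiForm Δ₁ k| < 1) (hΔ₁2 : ∀ k, |phiForm Δ₁ k| < wallDist a T)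
    (hm1 : 0 < phiForm Δ₁ k₁) (hm2 : phiForm Δ₁ k₂ < 0) {t : ℝ} (ht : 0 < t) (ht1 : t * xMax a < 1)
    (ht2 : t * xMax a < wallDist a T) :
    (torusN (b • sParam a + Δ₁) : ℝ) + torusN (b • sParam a - Δ₁) -
        (torusN (b • sParam a + t • sParam a) + torusN (b • sParam a - t • sParam a)) = -1 ∨
    (torusN (b • sParam a + Δ₁) : ℝ) + torusN (b • sParam a - Δ₁) -
        (torusN (b • sParam a + t • sParam a) + torusN (b • sParam a - t • sParam a)) = 0 ∨
    (torusN (b • sParam a + Δ₁) : ℝ) + torusN (b • sParam a - Δ₁) -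
        (torusN (b • sParam a + t • sParam a) + torusN (b • sParam a - t • sParam a)) = 1 := by
  have hmem : ∀ k, (∃ z : ℤ, b * h28 a k = z) → k = k₁ ∨ k = k₂ := by
    intro k ⟨z, hz⟩
    by_contra h
    push Not at h
    exact hother k h.1 h.2 z hz
  have hnz : ∀ k, (∃ z : ℤ, b * h28 a k = z) → phiForm Δ₁ k ≠ 0 := fun k hk => by
    rcases hmem k hk with rfl | rfl
    · exact hm1.ne'
    · exact hm2.ne
  have h := abs_reflDefect_le_card hpos hb hΔ₁1 hΔ₁2 hnz ht ht1 ht2 (S := {k₂}) fun k hk hn => by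
    rcases hmem k hk with rfl | rfl
    · exact absurd hn (not_lt.mpr hm1.le)
    · exact Finset.mem_singleton_self _
  rw [Finset.card_singleton, Nat.cast_one, abs_le] at h
  have hcast : (torusN (b • sParam a + Δ₁) : ℝ) + torusN (b • sParam a - Δ₁) -
      (torusN (b • sParam a + t • sParam a) + torusN (b • sParam a - t • sParam a)) =
      ((torusN (b • sParam a + Δ₁) + torusN (b • sParam a - Δ₁) -
        (torusN (b • sParam a + t • sParam a) + torusN (b • sParam a - t • sParam a)) : ℤ) : ℝ) := by
    push_cast; ring
  rw [hcast] at h ⊢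
  have h1 : (-1 : ℤ) ≤ torusN (b • sParam a + Δ₁) + torusN (b • sParam a - Δ₁) -
      (torusN (b • sParam a + t • sParam a) + torusN (b • sParam a - t • sParam a)) := by exact_mod_cast h.1
  have h2 : torusN (b • sParam a + Δ₁) + torusN (b • sParam a - Δ₁) -
      (torusN (b • sParam a + t • sParam a) + torusN (b • sParam a - t • sParam a)) ≤ (1 : ℤ) := by
    exact_mod_cast h.2
  rcases (by omega : torusN (b • sParam a + Δ₁) + torusN (b • sParam a - Δ₁) -
      (torusN (b • sParam a + t • sParam a) + torusN (b • sParam a - t • sParam a)) = -1 ∨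
    torusN (b • sParam a + Δ₁) + torusN (b • sParam a - Δ₁) -
      (torusN (b • sParam a + t • sParam a) + torusN (b • sParam a - t • sParam a)) = 0 ∨
    torusN (b • sParam a + Δ₁) + torusN (b • sParam a - Δ₁) -
      (torusN (b • sParam a + t • sParam a) + torusN (b • sParam a - t • sParam a)) = 1) with e | e | e
  · left; rw [e]; simp
  · right; left; rw [e]; simp
  · right; right; rw [e]; simp

/-- **THREE WALLS: EVERY PATTERN DEFECT HAS `|·| ≤ 1`.** If the member forms at `b ∈ bkpts a T` are among `k₁, k₂,
k₃` and the small displacement `Δ` has `φ_{k₁}(Δ), φ_{k₂}(Δ), φ_{k₃}(Δ) ≠ 0`, then its reflection defect against a line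
step `t` below the walls has absolute value `≤ 1` (of three signs, one occurs at most once: `min(#neg, #pos) ≤ 1`).
In particular three-wall pattern defects lie in `{−1, 0, +1}`; `±2` needs at least four walls. -/
theorem abs_reflDefect_three_wall_le_one {a : Dir} (hpos : ∀ k, 0 < h28 a k) {T b : ℝ} (hb : b ∈ bkpts a T)
    {k₁ k₂ k₃ : Fin 28} (hother : ∀ k, k ≠ k₁ → k ≠ k₂ → k ≠ k₃ → ∀ z : ℤ, b * h28 a k ≠ z)
    {Δ : Fin 8 → ℝ} (hΔ1 : ∀ k, |phiForm Δ k| < 1) (hΔ2 : ∀ k, |phiForm Δ k| < wallDist a T)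
    (hn1 : phiForm Δ k₁ ≠ 0) (hn2 : phiForm Δ k₂ ≠ 0) (hn3 : phiForm Δ k₃ ≠ 0)
    {t : ℝ} (ht : 0 < t) (ht1 : t * xMax a < 1) (ht2 : t * xMax a < wallDist a T) :
    |(torusN (b • sParam a + Δ) : ℝ) + torusN (b • sParam a - Δ) -
        (torusN (b • sParam a + t • sParam a) + torusN (b • sParam a - t • sParam a))| ≤ 1 := by
  have hmem : ∀ k, (∃ z : ℤ, b * h28 a k = z) → k = k₁ ∨ k = k₂ ∨ k = k₃ := by
    intro k ⟨z, hz⟩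
    by_contra h
    push Not at h
    exact hother k h.1 h.2.1 h.2.2 z hz
  have hnz : ∀ k, (∃ z : ℤ, b * h28 a k = z) → phiForm Δ k ≠ 0 := fun k hk => by
    rcases hmem k hk with rfl | rfl | rfl
    · exact hn1
    · exact hn2
    · exact hn3
  have negS : ∀ S : Finset (Fin 28), S.card ≤ 1 →
      (∀ k, (∃ z : ℤ, b * h28 a k = z) → phiForm Δ k < 0 → k ∈ S) →
      |(torusN (b • sParam a + Δ) : ℝ) + torusN (b • sParam a - Δ) -
        (torusN (b • sParam a + t • sParam a) + torusN (b • sParam a - t • sParam a))| ≤ 1 :=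
    fun S hc hS => (abs_reflDefect_le_card hpos hb hΔ1 hΔ2 hnz ht ht1 ht2 hS).trans (by exact_mod_cast hc)
  have posS : ∀ S : Finset (Fin 28), S.card ≤ 1 →
      (∀ k, (∃ z : ℤ, b * h28 a k = z) → 0 < phiForm Δ k → k ∈ S) →
      |(torusN (b • sParam a + Δ) : ℝ) + torusN (b • sParam a - Δ) -
        (torusN (b • sParam a + t • sParam a) + torusN (b • sParam a - t • sParam a))| ≤ 1 :=
    fun S hc hS => (abs_reflDefect_le_card_pos hpos hb hΔ1 hΔ2 hnz ht ht1 ht2 hS).trans (by exact_mod_cast hc)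
  have c0 : (∅ : Finset (Fin 28)).card ≤ 1 := by simp
  have c1 : ∀ k : Fin 28, ({k} : Finset (Fin 28)).card ≤ 1 := fun k => by simp
  rcases lt_or_gt_of_ne hn1 with h1 | h1 <;> rcases lt_or_gt_of_ne hn2 with h2 | h2 <;>
    rcases lt_or_gt_of_ne hn3 with h3 | h3
  · exact posS ∅ c0 fun k hk hs => by
      rcases hmem k hk with rfl | rfl | rfl <;> exact absurd hs (by linarith)
  · exact posS {k₃} (c1 k₃) fun k hk hs => by
      rcases hmem k hk with rfl | rfl | rfl <;> first | exact Finset.mem_singleton_self _ | exact absurd hs (by linarith)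
  · exact posS {k₂} (c1 k₂) fun k hk hs => by
      rcases hmem k hk with rfl | rfl | rfl <;> first | exact Finset.mem_singleton_self _ | exact absurd hs (by linarith)
  · exact negS {k₁} (c1 k₁) fun k hk hs => by
      rcases hmem k hk with rfl | rfl | rfl <;> first | exact Finset.mem_singleton_self _ | exact absurd hs (by linarith)
  · exact posS {k₁} (c1 k₁) fun k hk hs => by
      rcases hmem k hk with rfl | rfl | rfl <;> first | exact Finset.mem_singleton_self _ | exact absurd hs (by linarith)
  · exact negS {k₂} (c1 k₂) fun k hk hs => by
      rcases hmem k hk with rfl | rfl | rfl <;> first | exact Finset.mem_singleton_self _ | exact absurd hs (by linarith)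
  · exact negS {k₃} (c1 k₃) fun k hk hs => by
      rcases hmem k hk with rfl | rfl | rfl <;> first | exact Finset.mem_singleton_self _ | exact absurd hs (by linarith)
  · exact negS ∅ c0 fun k hk hs => by
      rcases hmem k hk with rfl | rfl | rfl <;> exact absurd hs (by linarith)

/-! ### The two-wall vote is bounded by the splitting -/

/-- **A TWO-WALL JUNCTION'S VOTE IS BOUNDED BY THE SPLITTING.** Under the hypotheses of `germ_symm_eq_two_wall`
(member forms among `k₁ ≠ k₂`, a small mixed reference `Δ₁`, a line step `t` below the walls, a scale `0 < η` with
`ηK < 1`, `ηK < wallDist`), for EVERY displacement `δ`: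
`|germR(δ) + germL(δ) + germR(−δ) + germL(−δ)| ≤ |φ_{k₁}(δ)/h_{k₁}(a) − φ_{k₂}(δ)/h_{k₂}(a)|`. -/
theorem abs_germ_symm_le_splitting_of_two_wall {a : Dir} (hpos : ∀ k, 0 < h28 a k) {T b : ℝ}
    (hb : b ∈ bkpts a T) {k₁ k₂ : Fin 28} (hother : ∀ k, k ≠ k₁ → k ≠ k₂ → ∀ z : ℤ, b * h28 a k ≠ z)
    (δ : Fin 8 → ℝ) {η : ℝ} (hη : 0 < η) (h1 : η * clusterBound a δ < 1)
    (h2 : η * clusterBound a δ < wallDist a T) {Δ₁ : Fin 8 → ℝ} (hΔ₁1 : ∀ k, |phiForm Δ₁ k| < 1)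
    (hΔ₁2 : ∀ k, |phiForm Δ₁ k| < wallDist a T) (hm1 : 0 < phiForm Δ₁ k₁) (hm2 : phiForm Δ₁ k₂ < 0)
    {t : ℝ} (ht : 0 < t) (ht1 : t * xMax a < 1) (ht2 : t * xMax a < wallDist a T) :
    |germR a δ η b + germL a δ η b + germR a (-δ) η b + germL a (-δ) η b| ≤
      |phiForm δ k₁ / h28 a k₁ - phiForm δ k₂ / h28 a k₂| := by
  rw [germ_symm_eq_two_wall hpos hb hother δ hη h1 h2 hΔ₁1 hΔ₁2 hm1 hm2 ht ht1 ht2, abs_mul, abs_abs]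
  have hD := reflDefect_two_wall_mem hpos hb hother hΔ₁1 hΔ₁2 hm1 hm2 ht ht1 ht2
  have hle : |(torusN (b • sParam a + Δ₁) : ℝ) + torusN (b • sParam a - Δ₁) -
      (torusN (b • sParam a + t • sParam a) + torusN (b • sParam a - t • sParam a))| ≤ 1 := by
    rcases hD with h | h | h <;> rw [h] <;> simp
  calc |(torusN (b • sParam a + Δ₁) : ℝ) + torusN (b • sParam a - Δ₁) -
        (torusN (b • sParam a + t • sParam a) + torusN (b • sParam a - t • sParam a))| *
        |phiForm δ k₁ / h28 a k₁ - phiForm δ k₂ / h28 a k₂|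
      ≤ 1 * |phiForm δ k₁ / h28 a k₁ - phiForm δ k₂ / h28 a k₂| :=
        mul_le_mul_of_nonneg_right hle (abs_nonneg _)
    _ = |phiForm δ k₁ / h28 a k₁ - phiForm δ k₂ / h28 a k₂| := one_mul _

end Summit.KontsevichZagierPeriods.Zeta5Search.Barrier.ConeGamma

end
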